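import Summits.QuantumFields.YangMills.Theorems.FluctuationComparisonRegPrIntLClassicalPerHeightOneStep
import Summits.QuantumFields.YangMills.Theorems.FluctuationComparisonRegPrIntLS2BetaWindowExactnessOfB8Thm2AtT3Members
import Summits.QuantumFields.YangMills.Theorems.UnitScaleTiltMinimiserStabilityRegPrSmoothLift
import Summits.QuantumFields.YangMills.Theorems.UnitScaleTiltMinimiserStabilityRegPrAvgActionDefect
import Summits.QuantumFields.YangMills.Theorems.UnitScaleTiltMinimiserStabilityRegPrCritCurvGradLog
import Summits.QuantumFields.YangMills.Theorems.UnitScaleTiltMinimiserStabilityRegPrProp8Iter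
import Summits.QuantumFields.YangMills.Theorems.UnitScaleTiltMinimiserStabilityRegPrStubHalvingStep
import HarnessLib

/-!
# S2α′ · `ClassicalPerHeight` — THE LIVE LINE's STUB `stub_classicalPerHeight` (`Cruxes/FluctuationComparisonRegPrIntL/Lines/runpair_organ.lean` v18.2 :689, text :366)
# IS DOWNSTREAM OF EXW∘ ALONE (registry stub 1 `stub_windowExactness` of LINE `semiclassical_s2beta` v11.4 :1381, text :715), BY KERNEL; hence it holds
# OUTRIGHT at every block size `L ≥ 5` and, for all `L`, CONDITIONALLY on the ONE named Literature fact `B8Thm2AtT3Members` (19200's ∕ EXW∘'s ∕ GAP♭∘'s trust base)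

Cell `ym3-torus` (HUMAN RULING D-0037; rung R3 = continuum `SU(2)` Yang–Mills on the three-torus at fixed lattice data — NOT d = 4, NOT infinite volume, NOT a mass gap,
NOT Clay).  Width seat `ym3-torus-px17` (gen 18); crux `stmt-QuantumFields-20520` (`…Theses.UnitScaleTilt.FluctuationComparisonRegPrIntL`); `--kind proof --supports
stmt-QuantumFields-20520 --as helper`, count-neutral; DEFINITION-FREE (0 `def`, 0 `instance`, 0 `notation`, 0 `sorry`, default heartbeats).

THE STATEMENT.  S2α′ `ClassicalPerHeight` (ideator `ym-r3-idea-1`, v9; idea-crit-5 #207 (a)) asks, per block size `L`, profile `(b₀, p₀)`, radius `ε₀`, member `F`, coupling `γ`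
and FIXED height `J`, for a null depth profile `A_J` with `|Δ²_{U V W Z}(β_K·m_{J,K} − β_{K′}·m_{J,K′})| ≤ A_J(K − J)` for all runs `J ≤ K ≤ K′` and all window quadrilaterals
(`m_{J,K} = minActionRegPr F J K ε₀`, print's constrained minimum (8) over the regular space (6) [Balaban1985Variational]; `β_K` the run's inverse coupling).  Since `Δ²` of four
window values is at most four sup-norms, it suffices that `K ↦ β_K·m_{J,K}` be UNIFORMLY CAUCHY on the window `PlaqSmall (θBal(b₀,p₀) J)` — NO rate is asked.

WHY THE 19200 CHAIN DOES NOT SERVE IT, AND WHAT DOES.  The tree's two-run comparison for crux 19200 (lit `T3UpperLiftSplitLog` ∕ `T3SplitLog`: UPPER by a smooth exact lift,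
LOWER by a one-step average, BOTH competitors placed in print's space (6)(ε₀) of the other run) compares the runs at the MOVING height `⌊K∕m⌋`; its competitors must satisfy the
DIVERGENCE clause (1.9) of (6), which is fed by the LOG-LIPSCHITZ curvature gradient `B₄ε₁((K−n)+1)L^{−3(K−n)}` of (8)-regular fields (cell finding F-g12-1; ✓`CritCurvGradLog`),
whence the threshold `(K+2)·θBal(⌊K∕m⌋) ≤ σ` — satisfiable along `⌊K∕m⌋`, NOT at a fixed height as `K → ∞`.  Here the competitors are instead GOOD-HISTORY FIBRE ELEMENTS: by
EXW∘ clause (1) (✓`windowExactness_body_five`, px13 g21: tower monotonicity from Thm 1 (8)) the regular minimum over an interior datum is below the action of EVERY element of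
`fibre ∩ histGood`, and `histGood` is a list of PLAQUETTE conditions (one per level) — no divergence clause.  The lift of EXW∘ (2)'s regular good-history minimiser inherits the
history below and meets the top level's window because `θBal` loses only `L^{−1∕2}` per level against the lift's `L^{−2}` (the history profile is `b₀∕cw` for the data window `b₀`,
`cw` small); the average of the next run's minimiser inherits its history outright.  The log factor is then harmless (`(k+1)L^{−k} ≤ 1`), and the radii at fixed `J` are
`β_K·O(θ²(k+2)²L^{−5k})·L^{3(m_F+K)} = C(L,F,γ,J)·(k+2)²·L^{−k}` (`k = K − J`), summable; the corner `K = J` is padded by the a-priori bound `β_K·2·#Plaq_K`.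

FILES 1∕3 ✓`…ClassicalPerHeightSteps` (history bookkeeping, the analysis-free 4-point end, arithmetic) and 2∕3 ✓`…ClassicalPerHeightOneStep` (`upper_step`, `lower_step`,
`step_radius_le`, `step_succ`) carry the pieces.
WHAT IS PROVED HERE (namespace `Summit.QuantumFields.YangMills.Theorems.FluctuationComparisonRegPrIntLClassicalPerHeightOfWindowExactness`; sorry-free, axioms standard).
* §1 ★★★★ `classicalPerHeightAt_of_windowExactnessAt : ⟨EXW∘ body at L⟩ → ⟨ClassicalPerHeight body at L⟩` (constants: Prop 8 = ✓`Prop8Iter.prop8_of_halvingLiteral stub_halvingStep`,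
  ✓`CritCurvGradLog.stub_critCurvGradLog`, ✓`SmoothLift.stub_smoothLift`, ✓`AvgActionDefect.stub_avgActionDefect`; EXW∘'s interior parameter `cw := min c₀ (C₁(B₃+B₄)+1)⁻¹`, history
  profile `(b₀∕cw, max p₀ pS)`; thresholds by lit ✓`exists_forall_θBal_le`; radii `(D(k+2)² + P)·L^{−k}`, `P` the a-priori padding of the corner `K = J`).
* §2 ★★★★★ `classicalPerHeight_body_five (L) (h5 : 5 ≤ L)` — ZERO hypotheses; ★★★★★ `classicalPerHeight_of_windowExactness : ⟨WindowExactness v11.4 TEXT⟩ → ⟨ClassicalPerHeight v18.2 TEXT⟩`;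
  `classicalPerHeight_of_thm1`, `classicalPerHeight_of_thm1AtThree`, ★★★★★ `classicalPerHeight_of_b8Thm2AtT3Members (hX : B8Thm2AtT3Members) : ⟨ClassicalPerHeight TEXT⟩`.

HONEST.  Composition BY NAME of landed theorems + threshold∕geometric-series arithmetic; the analytic content consumed is the tree's (Thm 1 (8) global reading at `L ≥ 5` = the
19200 guarded chain, the halving step, the log-Lipschitz curvature gradient of (8)-regular fields, the smooth exact lift, the averaging action defect); nothing of Bałaban's
analysis is added.  `stub_classicalPerHeight` itself quantifies over EVERY `L` incl. `L = 3` (EMBARGO-LITE №58: `B8Thm2AtT3Members` is a hypothesis, no Thm-2-at-3 attempt) and is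
NOT landed by this helper; S2β, the other stubs of both lines, crux 20520, 19936, 19200 and `YM3TorusSU2` are NOT proved; rung R3 = SU(2) YM₃ on T³ at fixed lattice data — NOT
d = 4, NOT infinite volume, NOT a mass gap, NOT Clay; the Yang–Mills mass gap is NOT proved.

References: T. Bałaban, CMP **102** (1985) 277–309 [Balaban1985Variational] (Thm 1 (6)–(10) pp.278–279, Prop. 8 p.304); CMP **102** (1985) 255–275 [Balaban1985UV3] ((3), (5) p.256,
(7) p.257, (41) p.266); CMP **98** (1985) 17–51 [Balaban1985Averaging] (Props 3–4, (125) p.36); C. King, CMP **102** (1986) 649–677 [King1986] ((A.5) p.676); P. Federbush,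
CMP **110** (1987) 293–309 [Federbush1987PhaseCellIII] (Thm 4.3 (4.5) p.299).
-/

set_option autoImplicit false

noncomputable section

namespace Summit.QuantumFields.YangMills.Theorems.FluctuationComparisonRegPrIntLClassicalPerHeightOfWindowExactness

open MeasureTheory Filter Topology
open scoped Matrix.Norms.L2Operator BigOperators
open Literature.MathematicalPhysics.QuantumFieldTheory.Balaban1983to89
open Literature.MathematicalPhysics.QuantumFieldTheory.Balaban1983to89.T3ContinuumYM3Torus
open Literature.MathematicalPhysics.QuantumFieldTheory.Balaban1983to89.T3UnitLawDensityEML (ℰp)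
open Literature.MathematicalPhysics.QuantumFieldTheory.Balaban1983to89.T3UnitScaleTilt
open Literature.MathematicalPhysics.QuantumFieldTheory.Balaban1983to89.T3TiltDescent
open Literature.MathematicalPhysics.QuantumFieldTheory.Balaban1983to89.T3CruxEstimates (plaqSmall_fieldShift)
open Literature.MathematicalPhysics.QuantumFieldTheory.Balaban1983to89.T3ConstrainedMinimiser (fibre)
open Literature.MathematicalPhysics.QuantumFieldTheory.Balaban1983to89.T3DescentFibreTower
open Literature.MathematicalPhysics.QuantumFieldTheory.Balaban1983to89.T3RegularMinimiser
open Literature.MathematicalPhysics.QuantumFieldTheory.Balaban1983to89.T3PrintedRegularMinimiser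
open Literature.MathematicalPhysics.QuantumFieldTheory.Balaban1983to89.T3PrintedMinimiserExistence
open Literature.MathematicalPhysics.QuantumFieldTheory.Balaban1983to89.T3MinimiserStabilityReduction (θBal_pos)
open Literature.MathematicalPhysics.QuantumFieldTheory.Balaban1983to89.T3ThresholdSmallness (exists_forall_θBal_le sqrt_coupling_pos_le)
open Literature.MathematicalPhysics.QuantumFieldTheory.Balaban1983to89.T3Thresholds (θBal_eq coupling_le_one)
open Literature.MathematicalPhysics.QuantumFieldTheory.Balaban1983to89.T3InteriorExcision (θBal_mul θBal_mul_le histGood_mono_profile)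
open Literature.MathematicalPhysics.QuantumFieldTheory.Balaban1983to89.T3LowerAlongMinimisersSplit
open Literature.MathematicalPhysics.QuantumFieldTheory.Balaban1983to89.T3UpperAlongMinimisersSplit
open Literature.MathematicalPhysics.QuantumFieldTheory.Balaban1983to89.T3UpperLiftSplit
open Literature.MathematicalPhysics.QuantumFieldTheory.Balaban1983to89.T3LowerActionSplit
open Literature.MathematicalPhysics.QuantumFieldTheory.Balaban1983to89.T3CurvGradLog
open Literature.MathematicalPhysics.QuantumFieldTheory.Balaban1983to89.T3Thm1Carrier (famX Idx minimisersIn8At_of_prop8)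
open Literature.MathematicalPhysics.QuantumFieldTheory.Balaban1983to89.T3B8Thm2AtMembers (B8Thm2AtT3Members)
open Literature.MathematicalPhysics.QuantumFieldTheory.Balaban1983to89.B10Eq27TorusAxialLog (toUField unitsField)
open Literature.MathematicalPhysics.QuantumFieldTheory.Balaban1983to89.B10Eq68TorusRegularity (plaqFT covDerivT covDivT)
open Literature.MathematicalPhysics.QuantumFieldTheory.Balaban1983to89.T4Continuum
open Summit.QuantumFields.YangMills.Theorems.PrintChi (pow_sqrt_inv_mul_θBal_le)
open Summit.QuantumFields.YangMills.Theorems.FluctuationComparisonRegPrIntLS2BetaWindowExactnessOfTower (windowExactness_at windowExactness_body_five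
  windowExactness_of_thm1 windowExactness_of_thm1AtThree)
open Summit.QuantumFields.YangMills.Theorems.FluctuationComparisonRegPrIntLS2BetaWindowExactnessOfB8Thm2AtT3Members (windowExactness_of_b8Thm2AtT3Members)
open Summit.QuantumFields.YangMills.Theorems.Thm1GuardedFiveResidueThree (thm1GlobalMinAt_five)
open Summit.QuantumFields.YangMills.Theorems.FluctuationComparisonRegPrIntLClassicalPerHeightSteps
open Summit.QuantumFields.YangMills.Theorems.FluctuationComparisonRegPrIntLClassicalPerHeightOneStep

/-! ## §1 ★★★ `ClassicalPerHeight`'s BODY AT ONE BLOCK SIZE FROM EXW∘'s BODY AT THAT BLOCK SIZE -/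

section Main

/-- ★★★★ **S2α′ AT ONE BLOCK SIZE ⟸ EXW∘ AT THAT BLOCK SIZE** (everything else from the tree: Prop 8 via the halving step, the log-Lipschitz curvature gradient of
(8)-regular fields, the smooth exact lift, the averaging action defect, the threshold arithmetic).  Hypothesis = EXW∘'s body at `L` VERBATIM; conclusion =
`ClassicalPerHeight`'s body at `L` VERBATIM. [cite: Balaban1985Variational, Thm 1 (8)-(10) p.279, Prop. 8 p.304; Balaban1985UV3, (3), (5) p.256, (7) p.257, (41) p.266; King1986, (A.5) p.676] -/
theorem classicalPerHeightAt_of_windowExactnessAt {L : ℕ}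
    (hW : ∃ c₀ : ℝ, 0 < c₀ ∧ c₀ ≤ 1 ∧ ∀ (cw : ℝ), 0 < cw → cw ≤ c₀ → ∃ pS : ℝ, ∀ (b₀ p₀ : ℝ), 0 < b₀ → pS ≤ p₀ → 0 < p₀ → ∃ ε₁ : ℝ, 0 < ε₁ ∧ ∀ (ε₀ : ℝ), 0 < ε₀ → ε₀ ≤ ε₁ →
    ∃ γ₁ : ℝ, 0 < γ₁ ∧ ∀ (F : T3Family) (γ : ℝ), F.L = L → 0 < γ → γ ≤ γ₁ →
      ∀ (J K : ℕ) (hJK : J ≤ K) (V : GaugeField (F.P J) 0 (Matrix.specialUnitaryGroup (Fin 2) ℂ)), PlaqSmall (θBal F.L γ (cw * b₀) p₀ J) V →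
        (∀ U ∈ fibre F ℰp J K hJK V, U ∈ histGood F ℰp (θBal F.L γ b₀ p₀) K J →
            minActionRegPr F J K hJK ε₀ V ≤ wilsonAction4 U) ∧
        (∃ U₀ ∈ regFibrePr F J K hJK ε₀ V, U₀ ∈ histGood F ℰp (θBal F.L γ b₀ p₀) K J ∧
            wilsonAction4 U₀ = minActionRegPr F J K hJK ε₀ V)) :
    ∀ (b₀ p₀ : ℝ), 0 < b₀ → 0 < p₀ → ∃ ε₁ : ℝ, 0 < ε₁ ∧ ∀ (ε₀ : ℝ), 0 < ε₀ → ε₀ ≤ ε₁ →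
    ∃ γ₁ : ℝ, 0 < γ₁ ∧ ∀ (F : T3Family) (γ : ℝ), F.L = L → 0 < γ → γ ≤ γ₁ →
      ∀ J : ℕ, ∃ A : ℕ → ℝ, (∀ n, 0 ≤ A n) ∧ Tendsto A atTop (𝓝 0) ∧
        ∀ (K K' : ℕ) (hJK : J ≤ K) (hJK' : J ≤ K'), K ≤ K' →
          ∀ (b b' : PBond (F.P J) 0) (U V W Z : GaugeField (F.P J) 0 (Matrix.specialUnitaryGroup (Fin 2) ℂ)),
            PlaqSmall (θBal F.L γ b₀ p₀ J) U → PlaqSmall (θBal F.L γ b₀ p₀ J) V →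
            PlaqSmall (θBal F.L γ b₀ p₀ J) W → PlaqSmall (θBal F.L γ b₀ p₀ J) Z →
            (∀ e, e ≠ b → U e = V e) → (∀ e, e ≠ b' → U e = W e) → (∀ e, e ≠ b' → V e = Z e) → (∀ e, e ≠ b → W e = Z e) →
            |((F.scheme ℰp γ).β K * minActionRegPr F J K hJK ε₀ U - (F.scheme ℰp γ).β K' * minActionRegPr F J K' hJK' ε₀ U)
              - ((F.scheme ℰp γ).β K * minActionRegPr F J K hJK ε₀ V - (F.scheme ℰp γ).β K' * minActionRegPr F J K' hJK' ε₀ V)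
              - (((F.scheme ℰp γ).β K * minActionRegPr F J K hJK ε₀ W - (F.scheme ℰp γ).β K' * minActionRegPr F J K' hJK' ε₀ W)
                - ((F.scheme ℰp γ).β K * minActionRegPr F J K hJK ε₀ Z - (F.scheme ℰp γ).β K' * minActionRegPr F J K' hJK' ε₀ Z))|
              ≤ A (K - J) := by
  intro b₀ p₀ hb hp
  by_cases hL : 1 < L
  swap
  · refine ⟨1, one_pos, fun ε₀ _ _ => ⟨1, one_pos, fun F γ hFL _ _ => ?_⟩⟩
    exact absurd (hFL ▸ F.hL.2) hL
  obtain ⟨c₀, hc₀, hc₀1, hW1⟩ := hW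
  -- the tree's constants at this block size
  obtain ⟨B₃, hB₃4, H8⟩ := Prop8Iter.prop8_of_halvingLiteral MinimiserStabilityRegPrStubHalvingStep.stub_halvingStep L hL
  have hB₃ : 0 < B₃ := by linarith
  obtain ⟨a₅, ha₅, hIn8⟩ := minimisersIn8At_of_prop8 hB₃ H8
  obtain ⟨a₁, B₄, ha₁, hB₄, hCG⟩ := CritCurvGradLog.stub_critCurvGradLog L hL B₃ hB₃4
  obtain ⟨C₁, C₂, c, hC₁, hC₂, hc, hSL⟩ := SmoothLift.stub_smoothLift L
  obtain ⟨E₂, e, hE₂, he, hAD⟩ := AvgActionDefect.stub_avgActionDefect L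
  -- the interior parameter `cw` (EXW∘'s window vs history profile), small enough for the lift's top level
  obtain ⟨cw, hcw0, hcwc₀, hcwC⟩ : ∃ cw : ℝ, 0 < cw ∧ cw ≤ c₀ ∧ C₁ * (B₃ + B₄) * cw ≤ 1 := by
    have hCB : 0 < C₁ * (B₃ + B₄) + 1 := by positivity
    refine ⟨min c₀ (1 / (C₁ * (B₃ + B₄) + 1)), lt_min hc₀ (by positivity), min_le_left _ _, ?_⟩
    have h1 : min c₀ (1 / (C₁ * (B₃ + B₄) + 1)) ≤ 1 / (C₁ * (B₃ + B₄) + 1) := min_le_right _ _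
    have h2 := mul_le_mul_of_nonneg_left h1 (show 0 ≤ C₁ * (B₃ + B₄) by positivity)
    have h3 : C₁ * (B₃ + B₄) * (1 / (C₁ * (B₃ + B₄) + 1)) ≤ 1 := by
      rw [mul_one_div, div_le_one hCB]; linarith
    exact h2.trans h3
  obtain ⟨pS, hW2⟩ := hW1 cw hcw0 hcwc₀
  -- the history profile `(b₀∕cw, max p₀ pS)` serving the data window `(b₀, p₀)`
  obtain ⟨b₀', hb', hcwb⟩ : ∃ b₀' : ℝ, 0 < b₀' ∧ cw * b₀' = b₀ := ⟨b₀ / cw, div_pos hb hcw0, by field_simp⟩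
  obtain ⟨p₀', hpp', hpS', hp'⟩ : ∃ p₀' : ℝ, p₀ ≤ p₀' ∧ pS ≤ p₀' ∧ 0 < p₀' :=
    ⟨max p₀ pS, le_max_left _ _, le_max_right _ _, hp.trans_le (le_max_left _ _)⟩
  obtain ⟨ε₁E, hε₁E, hW3⟩ := hW2 b₀' p₀' hb' hpS' hp'
  refine ⟨min ε₁E a₅, lt_min hε₁E ha₅, fun ε₀ hε₀ hε₀le => ?_⟩
  have hε₀E : ε₀ ≤ ε₁E := hε₀le.trans (min_le_left _ _)
  have hε₀a : ε₀ ≤ a₅ := hε₀le.trans (min_le_right _ _)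
  obtain ⟨γE, hγE, hW4⟩ := hW3 ε₀ hε₀ hε₀E
  -- thresholds on the Thm-1 radius `θBal(b₀, p₀′)(J)`, uniform in `J`
  obtain ⟨σ, hσ, hσ1, hσa₁, hσB, hσc₃, hσc₄, hσe₃, hσe₄⟩ : ∃ σ : ℝ, 0 < σ ∧ σ ≤ 1 ∧ σ ≤ a₁ ∧ B₃ * σ ≤ ε₀ ∧
      B₃ * σ ≤ c ∧ B₄ * σ ≤ c ∧ B₃ * σ ≤ e ∧ B₄ * σ ≤ e := by
    refine ⟨min (min 1 a₁) (min (ε₀ / B₃) (min (min (c / B₃) (c / B₄)) (min (e / B₃) (e / B₄)))), by positivity,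
      (min_le_left _ _).trans (min_le_left _ _), (min_le_left _ _).trans (min_le_right _ _), ?_, ?_, ?_, ?_, ?_⟩
    · have h : min (min 1 a₁) (min (ε₀ / B₃) (min (min (c / B₃) (c / B₄)) (min (e / B₃) (e / B₄)))) ≤ ε₀ / B₃ :=
        (min_le_right _ _).trans (min_le_left _ _)
      rwa [le_div_iff₀ hB₃, mul_comm] at h
    · have h : min (min 1 a₁) (min (ε₀ / B₃) (min (min (c / B₃) (c / B₄)) (min (e / B₃) (e / B₄)))) ≤ c / B₃ :=
        (min_le_right _ _).trans ((min_le_right _ _).trans ((min_le_left _ _).trans (min_le_left _ _)))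
      rwa [le_div_iff₀ hB₃, mul_comm] at h
    · have h : min (min 1 a₁) (min (ε₀ / B₃) (min (min (c / B₃) (c / B₄)) (min (e / B₃) (e / B₄)))) ≤ c / B₄ :=
        (min_le_right _ _).trans ((min_le_right _ _).trans ((min_le_left _ _).trans (min_le_right _ _)))
      rwa [le_div_iff₀ hB₄, mul_comm] at h
    · have h : min (min 1 a₁) (min (ε₀ / B₃) (min (min (c / B₃) (c / B₄)) (min (e / B₃) (e / B₄)))) ≤ e / B₃ :=
        (min_le_right _ _).trans ((min_le_right _ _).trans ((min_le_right _ _).trans (min_le_left _ _)))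
      rwa [le_div_iff₀ hB₃, mul_comm] at h
    · have h : min (min 1 a₁) (min (ε₀ / B₃) (min (min (c / B₃) (c / B₄)) (min (e / B₃) (e / B₄)))) ≤ e / B₄ :=
        (min_le_right _ _).trans ((min_le_right _ _).trans ((min_le_right _ _).trans (min_le_right _ _)))
      rwa [le_div_iff₀ hB₄, mul_comm] at h
  obtain ⟨γT, hγT, hT⟩ := exists_forall_θBal_le hL.le b₀ p₀' hσ
  refine ⟨min (min γE γT) 1, lt_min (lt_min hγE hγT) one_pos, fun F γ hFL hγ hγle J => ?_⟩
  have hγE' : γ ≤ γE := hγle.trans ((min_le_left _ _).trans (min_le_left _ _))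
  have hγT' : γ ≤ γT := hγle.trans ((min_le_left _ _).trans (min_le_right _ _))
  have hγ1 : γ ≤ 1 := hγle.trans (min_le_right _ _)
  have hL1F : 1 ≤ F.L := F.hL.2.le
  have hL0 : (0 : ℝ) < F.L := by exact_mod_cast (show 0 < F.L by omega)
  have hL1R : (1 : ℝ) < F.L := by exact_mod_cast F.hL.2
  -- the Thm-1 radius `θ` at height `J`
  obtain ⟨θ, hθ⟩ : ∃ θ : ℝ, θBal F.L γ b₀ p₀' J = θ := ⟨_, rfl⟩
  have hθpos : 0 < θ := by rw [← hθ]; exact θBal_pos hL1F hγ hγ1 hb p₀' J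
  have hθσ : θ ≤ σ := by rw [← hθ, hFL]; exact hT γ hγ hγT' J
  have hθ1 : θ ≤ 1 := hθσ.trans hσ1
  have hθa₁ : θ ≤ a₁ := hθσ.trans hσa₁
  have hB₃θ : B₃ * θ ≤ ε₀ := (mul_le_mul_of_nonneg_left hθσ hB₃.le).trans hσB
  have hB₃c : B₃ * θ ≤ c := (mul_le_mul_of_nonneg_left hθσ hB₃.le).trans hσc₃
  have hB₄c : B₄ * θ ≤ c := (mul_le_mul_of_nonneg_left hθσ hB₄.le).trans hσc₄
  have hB₃e : B₃ * θ ≤ e := (mul_le_mul_of_nonneg_left hθσ hB₃.le).trans hσe₃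
  have hB₄e : B₄ * θ ≤ e := (mul_le_mul_of_nonneg_left hθσ hB₄.le).trans hσe₄
  -- data windows: the `(b₀, p₀)` window lies in the Thm-1 window `θ` = EXW∘'s interior window `(cw·b₀′, p₀′)`
  have hwinθ : ∀ V : GaugeField (F.P J) 0 (Matrix.specialUnitaryGroup (Fin 2) ℂ), PlaqSmall (θBal F.L γ b₀ p₀ J) V → PlaqSmall θ V :=
    fun V hV p => (hV p).trans_le ((θBal_mono_p hL1F hγ hγ1 hb.le hpp' J).trans hθ.le)
  have hwincw : ∀ V : GaugeField (F.P J) 0 (Matrix.specialUnitaryGroup (Fin 2) ℂ), PlaqSmall (θBal F.L γ b₀ p₀ J) V →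
      PlaqSmall (θBal F.L γ (cw * b₀') p₀' J) V := by
    intro V hV
    rw [hcwb]
    exact fun p => (hV p).trans_le (θBal_mono_p hL1F hγ hγ1 hb.le hpp' J)
  -- the history profile `θBal(b₀′, p₀′)` has room above the lift at every depth `k ≥ 1`
  have htopk : ∀ k : ℕ, 1 ≤ k → C₁ * ((B₃ + B₄) * θ * ((F.L : ℝ)⁻¹) ^ (2 * k)) ≤ θBal F.L γ b₀' p₀' (J + k + 1) := by
    intro k hk
    have hΘJ : θBal F.L γ b₀' p₀' J = θ / cw := by
      rw [← hθ, ← hcwb, θBal_mul]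
      field_simp
    have hroom := pow_sqrt_inv_mul_θBal_le hL1F hγ hγ1 hb'.le hp'.le J (k + 1)
    rw [hΘJ, show J + (k + 1) = J + k + 1 by ring] at hroom
    have hsq := inv_pow_two_mul_le_sqrt_pow_succ F hk
    have hθcw : 0 ≤ θ / cw := (div_pos hθpos hcw0).le
    calc C₁ * ((B₃ + B₄) * θ * ((F.L : ℝ)⁻¹) ^ (2 * k))
        = (C₁ * (B₃ + B₄) * cw) * (θ / cw) * ((F.L : ℝ)⁻¹) ^ (2 * k) := by field_simp
      _ ≤ 1 * (θ / cw) * (Real.sqrt ((F.L : ℝ)⁻¹)) ^ (k + 1) :=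
          mul_le_mul (mul_le_mul_of_nonneg_right hcwC hθcw) hsq (by positivity) (by positivity)
      _ = (Real.sqrt ((F.L : ℝ)⁻¹)) ^ (k + 1) * (θ / cw) := by ring
      _ ≤ θBal F.L γ b₀' p₀' (J + k + 1) := hroom
  -- `g_K = β_K·m_{J,K}` as a function of `K ≥ J` (junk below `J`)
  classical
  obtain ⟨g, hg⟩ : ∃ g : ℕ → GaugeField (F.P J) 0 (Matrix.specialUnitaryGroup (Fin 2) ℂ) → ℝ,
      ∀ (K : ℕ) (h : J ≤ K) (V : GaugeField (F.P J) 0 (Matrix.specialUnitaryGroup (Fin 2) ℂ)),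
        g K V = (F.scheme ℰp γ).β K * minActionRegPr F J K h ε₀ V :=
    ⟨fun K V => if h : J ≤ K then (F.scheme ℰp γ).β K * minActionRegPr F J K h ε₀ V else 0, fun K h V => dif_pos h⟩
  -- a-priori bounds
  have hgb : ∀ (K : ℕ) (h : J ≤ K) (V : GaugeField (F.P J) 0 (Matrix.specialUnitaryGroup (Fin 2) ℂ)),
      0 ≤ g K V ∧ g K V ≤ (F.scheme ℰp γ).β K * (2 * (Fintype.card (Plaq (F.P K) 0) : ℝ)) := by
    intro K h V
    rw [hg K h V]
    exact ⟨mul_nonneg (F.scheme_β_nonneg ℰp hγ.le K) (minActionRegPr_nonneg F V),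
      mul_le_mul_of_nonneg_left (minActionRegPr_le_two_mul_card F V) (F.scheme_β_nonneg ℰp hγ.le K)⟩
  -- the radii
  obtain ⟨P, hP, hPJ⟩ : ∃ P : ℝ, 0 ≤ P ∧ (F.scheme ℰp γ).β J * (2 * (Fintype.card (Plaq (F.P J) 0) : ℝ)) +
      (F.scheme ℰp γ).β (J + 1) * (2 * (Fintype.card (Plaq (F.P (J + 1)) 0) : ℝ)) ≤ P :=
    ⟨_, add_nonneg (mul_nonneg (F.scheme_β_nonneg ℰp hγ.le J) (by positivity))
      (mul_nonneg (F.scheme_β_nonneg ℰp hγ.le (J + 1)) (by positivity)), le_rfl⟩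
  have hD : 0 ≤ (C₂ + E₂) * (B₄ ^ 2 + B₃ * B₄ + B₃ ^ 3) * ((F.L : ℝ) ^ (3 * F.m) * (F.L : ℝ) ^ (4 * J) / γ) := by positivity
  obtain ⟨D, hD0, hDdef⟩ : ∃ D : ℝ, 0 ≤ D ∧ (C₂ + E₂) * (B₄ ^ 2 + B₃ * B₄ + B₃ ^ 3) * ((F.L : ℝ) ^ (3 * F.m) * (F.L : ℝ) ^ (4 * J) / γ) = D :=
    ⟨_, hD, rfl⟩
  have hx0 : (0 : ℝ) ≤ (F.L : ℝ)⁻¹ := inv_nonneg.mpr hL0.le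
  obtain ⟨ρ, hρ0, hρs, hρP, hρD⟩ : ∃ ρ : ℕ → ℝ, (∀ k, 0 ≤ ρ k) ∧ Summable ρ ∧ P ≤ ρ 0 ∧
      ∀ k : ℕ, D * ((k : ℝ) + 2) ^ 2 * ((F.L : ℝ)⁻¹) ^ k ≤ ρ k := by
    refine ⟨fun k => (D * ((k : ℝ) + 2) ^ 2 + P) * ((F.L : ℝ)⁻¹) ^ k, fun k => by positivity, ?_, ?_, fun k => ?_⟩
    · have hx : ‖((F.L : ℝ)⁻¹)‖ < 1 := by
        rw [Real.norm_eq_abs, abs_of_nonneg hx0]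
        exact inv_lt_one_of_one_lt₀ hL1R
      have h2 := summable_pow_mul_geometric_of_norm_lt_one 2 hx
      have h1 := summable_pow_mul_geometric_of_norm_lt_one 1 hx
      have h0 := summable_geometric_of_norm_lt_one hx
      refine (((h2.mul_left D).add (h1.mul_left (4 * D))).add (h0.mul_left (4 * D + P))).congr fun k => ?_
      simp only [pow_one]
      ring
    · simp only [Nat.cast_zero, pow_zero, mul_one]
      have : 0 ≤ D * ((0 : ℝ) + 2) ^ 2 := by positivity
      linarith
    · have h1 : 0 ≤ P * ((F.L : ℝ)⁻¹) ^ k := by positivity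
      have h2 : (D * ((k : ℝ) + 2) ^ 2 + P) * ((F.L : ℝ)⁻¹) ^ k = D * ((k : ℝ) + 2) ^ 2 * ((F.L : ℝ)⁻¹) ^ k + P * ((F.L : ℝ)⁻¹) ^ k := by
        ring
      linarith
  -- ★ THE STEP BOUND, uniform on the window
  have hstep : ∀ k, ∀ V ∈ {V : GaugeField (F.P J) 0 (Matrix.specialUnitaryGroup (Fin 2) ℂ) | PlaqSmall (θBal F.L γ b₀ p₀ J) V},
      |g (J + k + 1) V - g (J + k) V| ≤ ρ k := by
    intro k V hV
    rcases k with _ | k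
    · -- depth `0 → 1`: the a-priori bounds
      have h0 := hgb J le_rfl V
      have h1 := hgb (J + 1) (Nat.le_succ J) V
      show |g (J + 1) V - g J V| ≤ ρ 0
      rw [abs_le]
      constructor <;> linarith [h0.1, h0.2, h1.1, h1.2]
    · -- depth `k+1 → k+2`
      have h := step_succ F hFL hγ hB₃ hB₄ hC₁ hC₂ hE₂ (hIn8 1) hCG hSL hAD hθpos hθ1 hθa₁ hε₀ hε₀a hB₃θ hB₃c hB₄c hB₃e hB₄e
        (Θ := θBal F.L γ b₀' p₀') J k (htopk (k + 1) (by omega)) (hwinθ V hV)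
        (hW4 F γ hFL hγ hγE' J (J + (k + 1)) (Nat.le_add_right J (k + 1)) V (hwincw V hV))
        (hW4 F γ hFL hγ hγE' J (J + (k + 1) + 1) (Nat.le_add_right J (k + 1 + 1)) V (hwincw V hV))
      rw [hDdef] at h
      rw [hg (J + (k + 1) + 1) (Nat.le_add_right J (k + 1 + 1)) V, hg (J + (k + 1)) (Nat.le_add_right J (k + 1)) V]
      exact h.trans (hρD (k + 1))
  -- the analysis-free end
  obtain ⟨A, hA0, hAt, hA4⟩ := fourPoint_profile_of_steps g _ J hρs hρ0 hstep
  refine ⟨A, hA0, hAt, fun K K' hJK hJK' hKK' b b' U V W Z hU hV hW hZ _ _ _ _ => ?_⟩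
  have h := hA4 K K' hJK hKK' U V W Z hU hV hW hZ
  rw [hg K hJK U, hg K' hJK' U, hg K hJK V, hg K' hJK' V, hg K hJK W, hg K' hJK' W, hg K hJK Z, hg K' hJK' Z] at h
  exact h

end Main

/-! ## §2 ★★★★★ S2α′ `ClassicalPerHeight` (TEXT VERBATIM): OUTRIGHT at every `L ≥ 5`; from EXW∘ (registry stub 1 of LINE `semiclassical_s2beta`, TEXT VERBATIM);
from Thm 1 (8); from Thm 1 (8) at `L = 3`; from the ONE named Literature fact `B8Thm2AtT3Members` -/

section Doors

/-- ★★★★★ **`ClassicalPerHeight`'s BODY AT EVERY BLOCK SIZE `L ≥ 5` — ZERO HYPOTHESES** (✓`windowExactness_body_five` ∘ §4): for the `SU(2)` d = 3 torus family, at every fixed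
height the renormalised constrained minimal actions `β_K·minActionRegPr F J K ε₀` of the runs `K ≥ J` are uniformly Cauchy on the window in 4-point currency.
[cite: Balaban1985Variational, Thm 1 (8) p.279, Prop. 8 p.304; Balaban1985UV3, (3), (5) p.256, (41) p.266] -/
theorem classicalPerHeight_body_five (L : ℕ) (h5 : 5 ≤ L) :
    ∀ (b₀ p₀ : ℝ), 0 < b₀ → 0 < p₀ → ∃ ε₁ : ℝ, 0 < ε₁ ∧ ∀ (ε₀ : ℝ), 0 < ε₀ → ε₀ ≤ ε₁ →
    ∃ γ₁ : ℝ, 0 < γ₁ ∧ ∀ (F : T3Family) (γ : ℝ), F.L = L → 0 < γ → γ ≤ γ₁ →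
      ∀ J : ℕ, ∃ A : ℕ → ℝ, (∀ n, 0 ≤ A n) ∧ Tendsto A atTop (𝓝 0) ∧
        ∀ (K K' : ℕ) (hJK : J ≤ K) (hJK' : J ≤ K'), K ≤ K' →
          ∀ (b b' : PBond (F.P J) 0) (U V W Z : GaugeField (F.P J) 0 (Matrix.specialUnitaryGroup (Fin 2) ℂ)),
            PlaqSmall (θBal F.L γ b₀ p₀ J) U → PlaqSmall (θBal F.L γ b₀ p₀ J) V →
            PlaqSmall (θBal F.L γ b₀ p₀ J) W → PlaqSmall (θBal F.L γ b₀ p₀ J) Z →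
            (∀ e, e ≠ b → U e = V e) → (∀ e, e ≠ b' → U e = W e) → (∀ e, e ≠ b' → V e = Z e) → (∀ e, e ≠ b → W e = Z e) →
            |((F.scheme ℰp γ).β K * minActionRegPr F J K hJK ε₀ U - (F.scheme ℰp γ).β K' * minActionRegPr F J K' hJK' ε₀ U)
              - ((F.scheme ℰp γ).β K * minActionRegPr F J K hJK ε₀ V - (F.scheme ℰp γ).β K' * minActionRegPr F J K' hJK' ε₀ V)
              - (((F.scheme ℰp γ).β K * minActionRegPr F J K hJK ε₀ W - (F.scheme ℰp γ).β K' * minActionRegPr F J K' hJK' ε₀ W)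
                - ((F.scheme ℰp γ).β K * minActionRegPr F J K hJK ε₀ Z - (F.scheme ℰp γ).β K' * minActionRegPr F J K' hJK' ε₀ Z))|
              ≤ A (K - J) :=
  classicalPerHeightAt_of_windowExactnessAt (windowExactness_body_five L h5)

/-- ★★★★★ **S2α′ ⟸ EXW∘, BY TEXT**: hypothesis = the v11.4 registry text of `WindowExactness` (`Lines/semiclassical_s2beta.lean` :715, `stub_windowExactness` :1381) VERBATIM;
conclusion = the v18.2 text of `ClassicalPerHeight` (`Lines/runpair_organ.lean` :366, `stub_classicalPerHeight` :689) VERBATIM.  One stub of the LIVE line is downstream of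
one stub of the REGISTERED line — by kernel. [cite: Balaban1985Variational, Thm 1 (8) p.279; Balaban1985UV3, (41) p.266] -/
theorem classicalPerHeight_of_windowExactness
    (hW : ∀ (L : ℕ), ∃ c₀ : ℝ, 0 < c₀ ∧ c₀ ≤ 1 ∧ ∀ (cw : ℝ), 0 < cw → cw ≤ c₀ → ∃ pS : ℝ, ∀ (b₀ p₀ : ℝ), 0 < b₀ → pS ≤ p₀ → 0 < p₀ → ∃ ε₁ : ℝ, 0 < ε₁ ∧ ∀ (ε₀ : ℝ), 0 < ε₀ → ε₀ ≤ ε₁ →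
    ∃ γ₁ : ℝ, 0 < γ₁ ∧ ∀ (F : T3Family) (γ : ℝ), F.L = L → 0 < γ → γ ≤ γ₁ →
      ∀ (J K : ℕ) (hJK : J ≤ K) (V : GaugeField (F.P J) 0 (Matrix.specialUnitaryGroup (Fin 2) ℂ)), PlaqSmall (θBal F.L γ (cw * b₀) p₀ J) V →
        (∀ U ∈ fibre F ℰp J K hJK V, U ∈ histGood F ℰp (θBal F.L γ b₀ p₀) K J →
            minActionRegPr F J K hJK ε₀ V ≤ wilsonAction4 U) ∧
        (∃ U₀ ∈ regFibrePr F J K hJK ε₀ V, U₀ ∈ histGood F ℰp (θBal F.L γ b₀ p₀) K J ∧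
            wilsonAction4 U₀ = minActionRegPr F J K hJK ε₀ V)) :
    ∀ (L : ℕ) (b₀ p₀ : ℝ), 0 < b₀ → 0 < p₀ → ∃ ε₁ : ℝ, 0 < ε₁ ∧ ∀ (ε₀ : ℝ), 0 < ε₀ → ε₀ ≤ ε₁ →
    ∃ γ₁ : ℝ, 0 < γ₁ ∧ ∀ (F : T3Family) (γ : ℝ), F.L = L → 0 < γ → γ ≤ γ₁ →
      ∀ J : ℕ, ∃ A : ℕ → ℝ, (∀ n, 0 ≤ A n) ∧ Tendsto A atTop (𝓝 0) ∧
        ∀ (K K' : ℕ) (hJK : J ≤ K) (hJK' : J ≤ K'), K ≤ K' →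
          ∀ (b b' : PBond (F.P J) 0) (U V W Z : GaugeField (F.P J) 0 (Matrix.specialUnitaryGroup (Fin 2) ℂ)),
            PlaqSmall (θBal F.L γ b₀ p₀ J) U → PlaqSmall (θBal F.L γ b₀ p₀ J) V →
            PlaqSmall (θBal F.L γ b₀ p₀ J) W → PlaqSmall (θBal F.L γ b₀ p₀ J) Z →
            (∀ e, e ≠ b → U e = V e) → (∀ e, e ≠ b' → U e = W e) → (∀ e, e ≠ b' → V e = Z e) → (∀ e, e ≠ b → W e = Z e) →
            |((F.scheme ℰp γ).β K * minActionRegPr F J K hJK ε₀ U - (F.scheme ℰp γ).β K' * minActionRegPr F J K' hJK' ε₀ U)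
              - ((F.scheme ℰp γ).β K * minActionRegPr F J K hJK ε₀ V - (F.scheme ℰp γ).β K' * minActionRegPr F J K' hJK' ε₀ V)
              - (((F.scheme ℰp γ).β K * minActionRegPr F J K hJK ε₀ W - (F.scheme ℰp γ).β K' * minActionRegPr F J K' hJK' ε₀ W)
                - ((F.scheme ℰp γ).β K * minActionRegPr F J K hJK ε₀ Z - (F.scheme ℰp γ).β K' * minActionRegPr F J K' hJK' ε₀ Z))|
              ≤ A (K - J) :=
  fun L => classicalPerHeightAt_of_windowExactnessAt (hW L)

/-- ★★★★ **S2α′ ⟸ [Balaban1985Variational] THM 1 (8) AT EVERY ODD BLOCK SIZE** (✓`windowExactness_of_thm1` ∘ the previous). [cite: Balaban1985Variational, Thm 1 (8) p.279, Prop. 7 p.299] -/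
theorem classicalPerHeight_of_thm1
    (hT : ∀ L : ℕ, Odd L → 1 < L → ∃ a₀ a₁ B₃ : ℝ, 0 < a₀ ∧ 0 < a₁ ∧ 0 < B₃ ∧ Thm1GlobalMinAt L a₀ a₁ B₃) :
    ∀ (L : ℕ) (b₀ p₀ : ℝ), 0 < b₀ → 0 < p₀ → ∃ ε₁ : ℝ, 0 < ε₁ ∧ ∀ (ε₀ : ℝ), 0 < ε₀ → ε₀ ≤ ε₁ →
    ∃ γ₁ : ℝ, 0 < γ₁ ∧ ∀ (F : T3Family) (γ : ℝ), F.L = L → 0 < γ → γ ≤ γ₁ →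
      ∀ J : ℕ, ∃ A : ℕ → ℝ, (∀ n, 0 ≤ A n) ∧ Tendsto A atTop (𝓝 0) ∧
        ∀ (K K' : ℕ) (hJK : J ≤ K) (hJK' : J ≤ K'), K ≤ K' →
          ∀ (b b' : PBond (F.P J) 0) (U V W Z : GaugeField (F.P J) 0 (Matrix.specialUnitaryGroup (Fin 2) ℂ)),
            PlaqSmall (θBal F.L γ b₀ p₀ J) U → PlaqSmall (θBal F.L γ b₀ p₀ J) V →
            PlaqSmall (θBal F.L γ b₀ p₀ J) W → PlaqSmall (θBal F.L γ b₀ p₀ J) Z →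
            (∀ e, e ≠ b → U e = V e) → (∀ e, e ≠ b' → U e = W e) → (∀ e, e ≠ b' → V e = Z e) → (∀ e, e ≠ b → W e = Z e) →
            |((F.scheme ℰp γ).β K * minActionRegPr F J K hJK ε₀ U - (F.scheme ℰp γ).β K' * minActionRegPr F J K' hJK' ε₀ U)
              - ((F.scheme ℰp γ).β K * minActionRegPr F J K hJK ε₀ V - (F.scheme ℰp γ).β K' * minActionRegPr F J K' hJK' ε₀ V)
              - (((F.scheme ℰp γ).β K * minActionRegPr F J K hJK ε₀ W - (F.scheme ℰp γ).β K' * minActionRegPr F J K' hJK' ε₀ W)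
                - ((F.scheme ℰp γ).β K * minActionRegPr F J K hJK ε₀ Z - (F.scheme ℰp γ).β K' * minActionRegPr F J K' hJK' ε₀ Z))|
              ≤ A (K - J) :=
  classicalPerHeight_of_windowExactness (windowExactness_of_thm1 hT)

/-- ★★★★ **S2α′ ⟸ THM 1 (8) AT `L = 3` ALONE** (✓`windowExactness_of_thm1AtThree`; every `L ≥ 5` by the tree, even `L` vacuous; `L = 3` = EMBARGO-LITE №58's socket).
[cite: Balaban1985Variational, Thm 1 (8) p.279; Balaban1985RegularSpaces, Thm 2 p.83] -/
theorem classicalPerHeight_of_thm1AtThree (hT₃ : ∃ a₀ a₁ B₃ : ℝ, 0 < a₀ ∧ 0 < a₁ ∧ 0 < B₃ ∧ Thm1GlobalMinAt 3 a₀ a₁ B₃) :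
    ∀ (L : ℕ) (b₀ p₀ : ℝ), 0 < b₀ → 0 < p₀ → ∃ ε₁ : ℝ, 0 < ε₁ ∧ ∀ (ε₀ : ℝ), 0 < ε₀ → ε₀ ≤ ε₁ →
    ∃ γ₁ : ℝ, 0 < γ₁ ∧ ∀ (F : T3Family) (γ : ℝ), F.L = L → 0 < γ → γ ≤ γ₁ →
      ∀ J : ℕ, ∃ A : ℕ → ℝ, (∀ n, 0 ≤ A n) ∧ Tendsto A atTop (𝓝 0) ∧
        ∀ (K K' : ℕ) (hJK : J ≤ K) (hJK' : J ≤ K'), K ≤ K' →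
          ∀ (b b' : PBond (F.P J) 0) (U V W Z : GaugeField (F.P J) 0 (Matrix.specialUnitaryGroup (Fin 2) ℂ)),
            PlaqSmall (θBal F.L γ b₀ p₀ J) U → PlaqSmall (θBal F.L γ b₀ p₀ J) V →
            PlaqSmall (θBal F.L γ b₀ p₀ J) W → PlaqSmall (θBal F.L γ b₀ p₀ J) Z →
            (∀ e, e ≠ b → U e = V e) → (∀ e, e ≠ b' → U e = W e) → (∀ e, e ≠ b' → V e = Z e) → (∀ e, e ≠ b → W e = Z e) →
            |((F.scheme ℰp γ).β K * minActionRegPr F J K hJK ε₀ U - (F.scheme ℰp γ).β K' * minActionRegPr F J K' hJK' ε₀ U)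
              - ((F.scheme ℰp γ).β K * minActionRegPr F J K hJK ε₀ V - (F.scheme ℰp γ).β K' * minActionRegPr F J K' hJK' ε₀ V)
              - (((F.scheme ℰp γ).β K * minActionRegPr F J K hJK ε₀ W - (F.scheme ℰp γ).β K' * minActionRegPr F J K' hJK' ε₀ W)
                - ((F.scheme ℰp γ).β K * minActionRegPr F J K hJK ε₀ Z - (F.scheme ℰp γ).β K' * minActionRegPr F J K' hJK' ε₀ Z))|
              ≤ A (K - J) :=
  classicalPerHeight_of_windowExactness (windowExactness_of_thm1AtThree hT₃)

/-- ★★★★★ **S2α′ `stub_classicalPerHeight`'s TEXT, CLOSED MODULO THE ONE NAMED LITERATURE FACT `B8Thm2AtT3Members` — NOTHING ELSE** (✓`windowExactness_of_b8Thm2AtT3Members` ∘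
`classicalPerHeight_of_windowExactness`): trust base = {`B8Thm2AtT3Members`} = 19200's = EXW∘'s = GAP♭∘'s.  CONDITIONAL; the stub is NOT landed by this (a stub lands
only hypothesis-free). [cite: Balaban1985Variational, Thm 1 (8) p.279, Prop. 8 p.304; Balaban1985RegularSpaces, Thm 2 p.83; Balaban1985UV3, (41) p.266] -/
theorem classicalPerHeight_of_b8Thm2AtT3Members (hX : B8Thm2AtT3Members) :
    ∀ (L : ℕ) (b₀ p₀ : ℝ), 0 < b₀ → 0 < p₀ → ∃ ε₁ : ℝ, 0 < ε₁ ∧ ∀ (ε₀ : ℝ), 0 < ε₀ → ε₀ ≤ ε₁ →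
    ∃ γ₁ : ℝ, 0 < γ₁ ∧ ∀ (F : T3Family) (γ : ℝ), F.L = L → 0 < γ → γ ≤ γ₁ →
      ∀ J : ℕ, ∃ A : ℕ → ℝ, (∀ n, 0 ≤ A n) ∧ Tendsto A atTop (𝓝 0) ∧
        ∀ (K K' : ℕ) (hJK : J ≤ K) (hJK' : J ≤ K'), K ≤ K' →
          ∀ (b b' : PBond (F.P J) 0) (U V W Z : GaugeField (F.P J) 0 (Matrix.specialUnitaryGroup (Fin 2) ℂ)),
            PlaqSmall (θBal F.L γ b₀ p₀ J) U → PlaqSmall (θBal F.L γ b₀ p₀ J) V →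
            PlaqSmall (θBal F.L γ b₀ p₀ J) W → PlaqSmall (θBal F.L γ b₀ p₀ J) Z →
            (∀ e, e ≠ b → U e = V e) → (∀ e, e ≠ b' → U e = W e) → (∀ e, e ≠ b' → V e = Z e) → (∀ e, e ≠ b → W e = Z e) →
            |((F.scheme ℰp γ).β K * minActionRegPr F J K hJK ε₀ U - (F.scheme ℰp γ).β K' * minActionRegPr F J K' hJK' ε₀ U)
              - ((F.scheme ℰp γ).β K * minActionRegPr F J K hJK ε₀ V - (F.scheme ℰp γ).β K' * minActionRegPr F J K' hJK' ε₀ V)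
              - (((F.scheme ℰp γ).β K * minActionRegPr F J K hJK ε₀ W - (F.scheme ℰp γ).β K' * minActionRegPr F J K' hJK' ε₀ W)
                - ((F.scheme ℰp γ).β K * minActionRegPr F J K hJK ε₀ Z - (F.scheme ℰp γ).β K' * minActionRegPr F J K' hJK' ε₀ Z))|
              ≤ A (K - J) :=
  classicalPerHeight_of_windowExactness (windowExactness_of_b8Thm2AtT3Members hX)

end Doors

end Summit.QuantumFields.YangMills.Theorems.FluctuationComparisonRegPrIntLClassicalPerHeightOfWindowExactness

end
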